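import Summits.NavierStokesRegularity.NavierStokesRegularity.Theorems.ExtremiserTransienceNearExtremalTransienceExtremiserLiouvilleConstantSpeedSlidePalinstrophySplit
import Summits.NavierStokesRegularity.NavierStokesRegularity.Theorems.ExtremiserTransienceNearExtremalTransienceExtremiserLiouvilleConstantSpeedSlidePalinstrophyFrobenius
import HarnessLib

/-!
# Crux `ExtremiserTransience.NearExtremalTransience` (stmt-NavierStokesRegularity-21883), line `extremiser_liouville`,
# stub K1b — THE `Z′`-BRACKET OF (INEQ)₃ IN `D²v`-FORM (R6b, Z′ half, step 2; record §17/§18)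

`--supports stmt-NavierStokesRegularity-21883` (helper).  Author: prover seat `ns-el-k1b` (g9).

Step 1 (`…SlidePalinstrophySplit`) split the palinstrophy variation `Ĉ₁` of (INEQ)₃ into nine integrals.  Here the second-order identities
are inserted: (P) for `−½∫g′|Dω|²_F` and (P) per direction for `d₃ = g′‖∂₂ω‖²` (`…SlidePalinstrophyFrobenius`, divergence-free `v`), the axial
rule for `d₂ = g″⟪∂₂ω,ω⟫ = −½∂₂`-form (`…SlideGenerator.integral_axialWeight_inner_fderiv_curl_eq`: `∫d₂ = −½∫g‴‖ω‖²`), and the pointwise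
cancellation `d₉ − d₇ = g′(|∇∇_hV₂|² − |∇∂₂V_h|²)` (`…SlidePalinstrophyCancellation`).  Result:
```
  Ĉ₁ = −½[Σₖ∫g′|D∂ₖv|²_F − ∫g‴|∇v₂|²] − [−½∫g‴‖ω‖² + (∫g′|D∂₂v|²_F − ∫g‴(∂₂v₂)²) + ∫d₄ + ∫d₅ + ∫Σd₆] + ∫d₈
       + ∫g′Σᵢ[(∂ᵢ∂₀v)₂² + (∂ᵢ∂₁v)₂² − (∂₂∂ᵢv)₀² − (∂₂∂ᵢv)₁²],
```
every `g′`-weighted second-order term now an explicit quadratic form in `D²v` (coercive except the `(∂ᵢ∂ₐv)₂²` Hessian-of-`V₂` entries,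
controlled by `…SlideJetKinematicsIntegrated` / `…SlideLayerGradientL4`), the rest `g″/g‴`-weighted lower-order terms and the first×second
order densities `d₄, d₅, d₆, d₈` (bounded in `…SlideCubicBounds`).
* `palinstrophyBracket_eq_secondOrder` : the displayed identity (left-hand side the `Ĉ₁` bracket of (INEQ)₃ verbatim).

WHAT THIS IS NOT: K1b is NOT proved; nothing here proves NS regularity. [folklore]
-/

noncomputable section

open Set Filter Topology MeasureTheory Metric Function InnerProductSpace
open scoped ENNReal NNReal Topology InnerProductSpace RealInnerProductSpace ContDiff
open Literature.Analysis.FluidPDE Literature.Analysis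

namespace Summit.NavierStokesRegularity.NavierStokesRegularity.Theorems

-- the problem directory repeats the summit name (`NavierStokesRegularity/NavierStokesRegularity`)
set_option linter.dupNamespace false

namespace ExtremiserLiouville

open DepletionLadder.KStar

variable {v : EuclideanSpace ℝ (Fin 3) → EuclideanSpace ℝ (Fin 3)} {c : EuclideanSpace ℝ (Fin 3)} {g : ℝ → ℝ}

/-- **The `Ĉ₁` bracket of (INEQ)₃ in `D²v`-form** (divergence-free `v ∈ C^∞`, `D¹v, D²v ∈ L²`; `g ∈ C^∞` with `|g′|,|g″|,|g‴| ≤ K` and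
`g‴ = 0` on `{|s| ≥ T}`; `‖v − c‖²` integrable on the slab). [folklore] -/
theorem palinstrophyBracket_eq_secondOrder (hv : ContDiff ℝ ∞ v) (hdiv : VectorCalculus.IsDivFree v) (hg : ContDiff ℝ ∞ g) {K T : ℝ}
    (hK1 : ∀ s, |deriv g s| ≤ K) (hK2 : ∀ s, |deriv (deriv g) s| ≤ K) (hK3 : ∀ s, |deriv (deriv (deriv g)) s| ≤ K)
    (hT3 : ∀ s, T ≤ |s| → deriv (deriv (deriv g)) s = 0)
    (h1 : ∫⁻ x, ‖iteratedFDeriv ℝ 1 v x‖ₑ ^ 2 < ⊤) (h2 : ∫⁻ x, ‖iteratedFDeriv ℝ 2 v x‖ₑ ^ 2 < ⊤)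
    (hslab : Integrable (fun x => {x : EuclideanSpace ℝ (Fin 3) | |x 2| ≤ T}.indicator (fun x => ‖v x - c‖ ^ 2) x) volume) :
    (-((1 / 2) * ∫ x, deriv g (x 2) * frobeniusNormSq (fderiv ℝ (curl v) x)) -
          (∫ x, deriv (deriv g) (x 2) * ⟪fderiv ℝ (curl v) x (EuclideanSpace.single (2 : Fin 3) (1 : ℝ)), curl v x⟫ +
        deriv g (x 2) * ‖fderiv ℝ (curl v) x (EuclideanSpace.single (2 : Fin 3) (1 : ℝ))‖ ^ 2 +
        deriv (deriv (deriv g)) (x 2) * ⟪fderiv ℝ (curl v) x (EuclideanSpace.single (2 : Fin 3) (1 : ℝ)),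
          (-(v x - c) 1) • EuclideanSpace.single (0 : Fin 3) (1 : ℝ) + ((v x - c) 0) • EuclideanSpace.single (1 : Fin 3) (1 : ℝ)⟫ +
        deriv (deriv g) (x 2) * ⟪fderiv ℝ (curl v) x (EuclideanSpace.single (2 : Fin 3) (1 : ℝ)),
          fderiv ℝ (fun z : EuclideanSpace ℝ (Fin 3) =>
            (-(v z - c) 1) • EuclideanSpace.single (0 : Fin 3) (1 : ℝ) + ((v z - c) 0) • EuclideanSpace.single (1 : Fin 3) (1 : ℝ)) x
            (EuclideanSpace.single (2 : Fin 3) (1 : ℝ))⟫ +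
        ∑ i : Fin 3, (deriv (deriv g) (x 2) * ⟪fderiv ℝ (curl v) x (EuclideanSpace.basisFun (Fin 3) ℝ i),
            fderiv ℝ (fun z : EuclideanSpace ℝ (Fin 3) =>
              (-(v z - c) 1) • EuclideanSpace.single (0 : Fin 3) (1 : ℝ) + ((v z - c) 0) • EuclideanSpace.single (1 : Fin 3) (1 : ℝ)) x
              (EuclideanSpace.basisFun (Fin 3) ℝ i)⟫ +
          deriv g (x 2) * ⟪fderiv ℝ (curl v) x (EuclideanSpace.basisFun (Fin 3) ℝ i),
            fderiv ℝ (fun y : EuclideanSpace ℝ (Fin 3) => fderiv ℝ (fun z : EuclideanSpace ℝ (Fin 3) =>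
              (-(v z - c) 1) • EuclideanSpace.single (0 : Fin 3) (1 : ℝ) + ((v z - c) 0) • EuclideanSpace.single (1 : Fin 3) (1 : ℝ)) y
              (EuclideanSpace.basisFun (Fin 3) ℝ i)) x (EuclideanSpace.single (2 : Fin 3) (1 : ℝ))⟫)) +
          ∫ x, deriv (deriv g) (x 2) * (fderiv ℝ (curl v) x (EuclideanSpace.single (2 : Fin 3) (1 : ℝ)) 0 * fderiv ℝ v x (EuclideanSpace.single (1 : Fin 3) (1 : ℝ)) 2 -
          fderiv ℝ (curl v) x (EuclideanSpace.single (2 : Fin 3) (1 : ℝ)) 1 * fderiv ℝ v x (EuclideanSpace.single (0 : Fin 3) (1 : ℝ)) 2) +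
        deriv g (x 2) * ∑ i : Fin 3, (fderiv ℝ (curl v) x (EuclideanSpace.basisFun (Fin 3) ℝ i) 0 *
            fderiv ℝ (fun y => fderiv ℝ v y (EuclideanSpace.single (1 : Fin 3) (1 : ℝ))) x (EuclideanSpace.basisFun (Fin 3) ℝ i) 2 -
          fderiv ℝ (curl v) x (EuclideanSpace.basisFun (Fin 3) ℝ i) 1 *
            fderiv ℝ (fun y => fderiv ℝ v y (EuclideanSpace.single (0 : Fin 3) (1 : ℝ))) x (EuclideanSpace.basisFun (Fin 3) ℝ i) 2)) =
    -((1 / 2) * ((∫ x : EuclideanSpace ℝ (Fin 3), deriv g (x 2) * ∑ k : Fin 3, frobeniusNormSq (fderiv ℝ (fun z => fderiv ℝ v z (EuclideanSpace.basisFun (Fin 3) ℝ k)) x)) -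
        ∫ x : EuclideanSpace ℝ (Fin 3), deriv (deriv (deriv g)) (x 2) * ∑ k : Fin 3, (fderiv ℝ v x (EuclideanSpace.basisFun (Fin 3) ℝ k) 2) ^ 2)) -
      ((-(1 / 2) * ∫ x : EuclideanSpace ℝ (Fin 3), deriv (deriv (deriv g)) (x 2) * ‖curl v x‖ ^ 2) +
       ((∫ x : EuclideanSpace ℝ (Fin 3), deriv g (x 2) * frobeniusNormSq (fderiv ℝ (fun z => fderiv ℝ v z (EuclideanSpace.single (2 : Fin 3) (1 : ℝ))) x)) -
        ∫ x : EuclideanSpace ℝ (Fin 3), deriv (deriv (deriv g)) (x 2) * (fderiv ℝ v x (EuclideanSpace.single (2 : Fin 3) (1 : ℝ)) 2) ^ 2) +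
       (∫ x : EuclideanSpace ℝ (Fin 3), deriv (deriv (deriv g)) (x 2) * ⟪fderiv ℝ (curl v) x (EuclideanSpace.single (2 : Fin 3) (1 : ℝ)),
          (-(v x - c) 1) • EuclideanSpace.single (0 : Fin 3) (1 : ℝ) + ((v x - c) 0) • EuclideanSpace.single (1 : Fin 3) (1 : ℝ)⟫) +
       (∫ x : EuclideanSpace ℝ (Fin 3), deriv (deriv g) (x 2) * ⟪fderiv ℝ (curl v) x (EuclideanSpace.single (2 : Fin 3) (1 : ℝ)),
          fderiv ℝ (fun z : EuclideanSpace ℝ (Fin 3) => (-(v z - c) 1) • EuclideanSpace.single (0 : Fin 3) (1 : ℝ) + ((v z - c) 0) • EuclideanSpace.single (1 : Fin 3) (1 : ℝ)) x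
            (EuclideanSpace.single (2 : Fin 3) (1 : ℝ))⟫) +
       (∫ x : EuclideanSpace ℝ (Fin 3), ∑ i : Fin 3, deriv (deriv g) (x 2) * ⟪fderiv ℝ (curl v) x (EuclideanSpace.basisFun (Fin 3) ℝ i),
            fderiv ℝ (fun z : EuclideanSpace ℝ (Fin 3) => (-(v z - c) 1) • EuclideanSpace.single (0 : Fin 3) (1 : ℝ) + ((v z - c) 0) • EuclideanSpace.single (1 : Fin 3) (1 : ℝ)) x
              (EuclideanSpace.basisFun (Fin 3) ℝ i)⟫)) +
      (∫ x : EuclideanSpace ℝ (Fin 3), deriv (deriv g) (x 2) * (fderiv ℝ (curl v) x (EuclideanSpace.single (2 : Fin 3) (1 : ℝ)) 0 * fderiv ℝ v x (EuclideanSpace.single (1 : Fin 3) (1 : ℝ)) 2 -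
          fderiv ℝ (curl v) x (EuclideanSpace.single (2 : Fin 3) (1 : ℝ)) 1 * fderiv ℝ v x (EuclideanSpace.single (0 : Fin 3) (1 : ℝ)) 2)) + (∫ x : EuclideanSpace ℝ (Fin 3), deriv g (x 2) * ∑ i : Fin 3, (fderiv ℝ (fun y => fderiv ℝ v y (EuclideanSpace.single (0 : Fin 3) (1 : ℝ))) x (EuclideanSpace.basisFun (Fin 3) ℝ i) 2 ^ 2 + fderiv ℝ (fun y => fderiv ℝ v y (EuclideanSpace.single (1 : Fin 3) (1 : ℝ))) x (EuclideanSpace.basisFun (Fin 3) ℝ i) 2 ^ 2 - fderiv ℝ (fun y => fderiv ℝ v y (EuclideanSpace.basisFun (Fin 3) ℝ i)) x (EuclideanSpace.single (2 : Fin 3) (1 : ℝ)) 0 ^ 2 - fderiv ℝ (fun y => fderiv ℝ v y (EuclideanSpace.basisFun (Fin 3) ℝ i)) x (EuclideanSpace.single (2 : Fin 3) (1 : ℝ)) 1 ^ 2)) := by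
  rw [palinstrophyBracket_eq_split hv hg hK1 hK2 hK3 hT3 h1 h2 hslab]
  have lt2 : (2 : WithTop ℕ∞) ≤ ((⊤ : ℕ∞) : WithTop ℕ∞) := WithTop.coe_le_coe.mpr le_top
  have hv2 : ContDiff ℝ 2 v := hv.of_le lt2
  -- `D¹v, D²v, ω ∈ L²`
  obtain ⟨iW2, iP2⟩ := integrable_sq_curl_and_fderiv hv h1
  have iQ2 : Integrable (fun x : EuclideanSpace ℝ (Fin 3) => ‖iteratedFDeriv ℝ 2 v x‖ ^ 2) volume :=
    integrable_sq_norm_of_lintegral (hv.continuous_iteratedFDeriv (WithTop.coe_le_coe.mpr le_top)) h2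
  -- the weight `γ = g′ ∈ C²`
  have hg1 : ContDiff ℝ (⊤ : ℕ∞) (deriv g) := by simpa using hg.iterate_deriv 1
  have hg2 : ContDiff ℝ (⊤ : ℕ∞) (deriv (deriv g)) := by simpa using hg.iterate_deriv 2
  have hγ2 : ContDiff ℝ 2 (deriv g) := hg1.of_le lt2
  -- (P) and (P) per direction `e₂`
  have hP := integral_axialWeight_frobeniusNormSq_fderiv_curl_eq (γ := deriv g) hv hdiv hγ2 hK1 hK2 hK3 iP2 iQ2
  have hP2 := integral_axialWeight_sq_norm_fderiv_curl_apply_eq (γ := deriv g) hv hdiv hγ2 hK1 hK2 hK3 iP2 iQ2 (EuclideanSpace.single (2 : Fin 3) (1 : ℝ))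
  -- the axial rule for `d₂`
  have n2 : ‖(EuclideanSpace.single (2 : Fin 3) (1 : ℝ) : EuclideanSpace ℝ (Fin 3))‖ = 1 := by rw [PiLp.norm_single, norm_one]
  have hZD : Integrable (fun x : EuclideanSpace ℝ (Fin 3) => ‖curl v x‖ * ‖fderiv ℝ (curl v) x (EuclideanSpace.single (2 : Fin 3) (1 : ℝ))‖) volume := by
    have cω : Continuous (curl v) := (contDiff_curl (n := ⊤) hv).continuous
    have cDω : Continuous fun x => fderiv ℝ (curl v) x (EuclideanSpace.single (2 : Fin 3) (1 : ℝ)) :=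
      ((contDiff_curl (n := ⊤) hv).continuous_fderiv (by simp)).clm_apply continuous_const
    refine ((iW2.const_mul 1).add (iQ2.const_mul 4)).mono' (cω.norm.mul cDω.norm).aestronglyMeasurable (Eventually.of_forall fun x => ?_)
    simp only [Pi.add_apply]
    rw [Real.norm_eq_abs, abs_of_nonneg (mul_nonneg (norm_nonneg _) (norm_nonneg _))]
    have h := norm_iteratedFDeriv_curl_le_four hv 1 x
    rw [← norm_iteratedFDeriv_fderiv, norm_iteratedFDeriv_zero] at h
    have a1 : ‖fderiv ℝ (curl v) x (EuclideanSpace.single (2 : Fin 3) (1 : ℝ))‖ ≤ 4 * ‖iteratedFDeriv ℝ 2 v x‖ :=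
      ((fderiv ℝ (curl v) x).le_opNorm _).trans (by rw [n2, mul_one]; exact h)
    nlinarith [sq_nonneg (‖curl v x‖ - 2 * ‖iteratedFDeriv ℝ 2 v x‖), norm_nonneg (curl v x), norm_nonneg (iteratedFDeriv ℝ 2 v x),
      mul_le_mul_of_nonneg_left a1 (norm_nonneg (curl v x))]
  have hD2 : (∫ x : EuclideanSpace ℝ (Fin 3), deriv (deriv g) (x 2) * ⟪fderiv ℝ (curl v) x (EuclideanSpace.single (2 : Fin 3) (1 : ℝ)), curl v x⟫) = (-(1 / 2) * ∫ x : EuclideanSpace ℝ (Fin 3), deriv (deriv (deriv g)) (x 2) * ‖curl v x‖ ^ 2) := by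
    have e1 : (∫ x : EuclideanSpace ℝ (Fin 3), deriv (deriv g) (x 2) * ⟪fderiv ℝ (curl v) x (EuclideanSpace.single (2 : Fin 3) (1 : ℝ)), curl v x⟫) = ∫ x : EuclideanSpace ℝ (Fin 3), deriv (deriv g) (x 2) * ⟪curl v x, fderiv ℝ (curl v) x (EuclideanSpace.single (2 : Fin 3) (1 : ℝ))⟫ :=
      integral_congr_ae (Eventually.of_forall fun x => by simp only; rw [real_inner_comm])
    rw [e1]
    exact integral_axialWeight_inner_fderiv_curl_eq hv2 iW2 hZD (hg2.of_le (by exact_mod_cast le_top)) hK2 hK3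
  -- the cancellation `d₉ − d₇` (integrability of `d₇`, `d₉` as in the split file)
  have hK10 : 0 ≤ K := (abs_nonneg _).trans (hK1 0)
  have hvd : Differentiable ℝ v := hv.differentiable (by simp)
  have hVs : ContDiff ℝ ∞ (fun z => v z - c) := hv.sub contDiff_const
  have hVs2 : ContDiff ℝ 2 (fun z => v z - c) := hVs.of_le lt2
  have hVsd : Differentiable ℝ (fun z => v z - c) := hVs.differentiable (by simp)
  have hBc : ContDiff ℝ ∞ (fun z : EuclideanSpace ℝ (Fin 3) => (-(v z - c) 1) • EuclideanSpace.single (0 : Fin 3) (1 : ℝ) + ((v z - c) 0) • EuclideanSpace.single (1 : Fin 3) (1 : ℝ)) := contDiff_crossField hVs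
  have c2 : Continuous fun x : EuclideanSpace ℝ (Fin 3) => x 2 := PiLp.continuous_apply 2 _ (2 : Fin 3)
  have cg1 : Continuous fun x : EuclideanSpace ℝ (Fin 3) => deriv g (x 2) := hg1.continuous.comp c2
  have cDω : ∀ w : EuclideanSpace ℝ (Fin 3), Continuous fun x => fderiv ℝ (curl v) x w := fun w =>
    ((contDiff_curl (n := ⊤) hv).continuous_fderiv (by simp)).clm_apply continuous_const
  have cDDB : ∀ (w u : EuclideanSpace ℝ (Fin 3)), Continuous fun x => fderiv ℝ (fun y : EuclideanSpace ℝ (Fin 3) => fderiv ℝ (fun z : EuclideanSpace ℝ (Fin 3) => (-(v z - c) 1) • EuclideanSpace.single (0 : Fin 3) (1 : ℝ) + ((v z - c) 0) • EuclideanSpace.single (1 : Fin 3) (1 : ℝ)) y w) x u := fun w u =>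
    ((((hBc.fderiv_right (m := ∞) (by exact_mod_cast le_rfl)).clm_apply contDiff_const).continuous_fderiv (by simp))).clm_apply continuous_const
  have cHv : ∀ (w u : EuclideanSpace ℝ (Fin 3)), Continuous fun x => fderiv ℝ (fun y => fderiv ℝ v y w) x u := fun w u =>
    ((((hv.fderiv_right (m := ∞) (by exact_mod_cast le_rfl)).clm_apply contDiff_const).continuous_fderiv (by simp))).clm_apply continuous_const
  have cco : ∀ {f : EuclideanSpace ℝ (Fin 3) → EuclideanSpace ℝ (Fin 3)} (i : Fin 3), Continuous f → Continuous fun x => f x i := fun i hf =>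
    (EuclideanSpace.proj i : EuclideanSpace ℝ (Fin 3) →L[ℝ] ℝ).continuous.comp hf
  have nb : ∀ k : Fin 3, ‖EuclideanSpace.basisFun (Fin 3) ℝ k‖ = 1 := fun k => (EuclideanSpace.basisFun (Fin 3) ℝ).orthonormal.norm_eq_one k
  have nDω : ∀ (x w : EuclideanSpace ℝ (Fin 3)), ‖w‖ = 1 → ‖fderiv ℝ (curl v) x w‖ ≤ 4 * ‖iteratedFDeriv ℝ 2 v x‖ := fun x w hw => by
    have h := norm_iteratedFDeriv_curl_le_four hv 1 x
    rw [← norm_iteratedFDeriv_fderiv, norm_iteratedFDeriv_zero] at h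
    exact ((fderiv ℝ (curl v) x).le_opNorm w).trans (by rw [hw, mul_one]; exact h)
  have nDDB : ∀ (x w u : EuclideanSpace ℝ (Fin 3)), ‖w‖ = 1 → ‖u‖ = 1 → ‖fderiv ℝ (fun y : EuclideanSpace ℝ (Fin 3) => fderiv ℝ (fun z : EuclideanSpace ℝ (Fin 3) => (-(v z - c) 1) • EuclideanSpace.single (0 : Fin 3) (1 : ℝ) + ((v z - c) 0) • EuclideanSpace.single (1 : Fin 3) (1 : ℝ)) y w) x u‖ ≤ ‖iteratedFDeriv ℝ 2 v x‖ := fun x w u hw hu => by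
    rw [fderiv_fderiv_crossField_apply (V := fun z => v z - c) hVs2 x w u]
    refine (norm_cross_le _).trans ?_
    simp only [fderiv_sub_const]
    rw [fderiv_fderiv_apply_eq hv2 x]
    have e1 : ‖fderiv ℝ (fderiv ℝ v) x‖ = ‖iteratedFDeriv ℝ 2 v x‖ := by
      rw [← norm_iteratedFDeriv_zero (𝕜 := ℝ) (f := fderiv ℝ (fderiv ℝ v)), norm_iteratedFDeriv_fderiv, norm_iteratedFDeriv_fderiv]
    calc ‖fderiv ℝ (fderiv ℝ v) x w u‖ ≤ ‖fderiv ℝ (fderiv ℝ v) x w‖ * ‖u‖ := (fderiv ℝ (fderiv ℝ v) x w).le_opNorm u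
      _ ≤ ‖fderiv ℝ (fderiv ℝ v) x‖ * ‖w‖ * ‖u‖ := mul_le_mul_of_nonneg_right ((fderiv ℝ (fderiv ℝ v) x).le_opNorm w) (norm_nonneg _)
      _ = ‖iteratedFDeriv ℝ 2 v x‖ := by rw [hw, hu, mul_one, mul_one, e1]
  have nHv : ∀ (x w u : EuclideanSpace ℝ (Fin 3)), ‖w‖ = 1 → ‖u‖ = 1 → ‖fderiv ℝ (fun y => fderiv ℝ v y w) x u‖ ≤ ‖iteratedFDeriv ℝ 2 v x‖ := fun x w u hw hu => by
    rw [fderiv_fderiv_apply_eq hv2 x]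
    have e1 : ‖fderiv ℝ (fderiv ℝ v) x‖ = ‖iteratedFDeriv ℝ 2 v x‖ := by
      rw [← norm_iteratedFDeriv_zero (𝕜 := ℝ) (f := fderiv ℝ (fderiv ℝ v)), norm_iteratedFDeriv_fderiv, norm_iteratedFDeriv_fderiv]
    calc ‖fderiv ℝ (fderiv ℝ v) x w u‖ ≤ ‖fderiv ℝ (fderiv ℝ v) x w‖ * ‖u‖ := (fderiv ℝ (fderiv ℝ v) x w).le_opNorm u
      _ ≤ ‖fderiv ℝ (fderiv ℝ v) x‖ * ‖w‖ * ‖u‖ := mul_le_mul_of_nonneg_right ((fderiv ℝ (fderiv ℝ v) x).le_opNorm w) (norm_nonneg _)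
      _ = ‖iteratedFDeriv ℝ 2 v x‖ := by rw [hw, hu, mul_one, mul_one, e1]
  have ac : ∀ (z : EuclideanSpace ℝ (Fin 3)) (i : Fin 3), |z i| ≤ ‖z‖ := fun z i => abs_apply_le_norm z i
  have iD7 : Integrable (fun x : EuclideanSpace ℝ (Fin 3) => ∑ i : Fin 3, deriv g (x 2) * ⟪fderiv ℝ (curl v) x (EuclideanSpace.basisFun (Fin 3) ℝ i),
            fderiv ℝ (fun y : EuclideanSpace ℝ (Fin 3) => fderiv ℝ (fun z : EuclideanSpace ℝ (Fin 3) => (-(v z - c) 1) • EuclideanSpace.single (0 : Fin 3) (1 : ℝ) + ((v z - c) 0) • EuclideanSpace.single (1 : Fin 3) (1 : ℝ)) y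
              (EuclideanSpace.basisFun (Fin 3) ℝ i)) x (EuclideanSpace.single (2 : Fin 3) (1 : ℝ))⟫) volume := by
    refine integrable_finsetSum _ fun i _ => ?_
    refine (iQ2.const_mul (K * 4)).mono' (cg1.mul ((cDω _).inner (cDDB _ _))).aestronglyMeasurable (Eventually.of_forall fun x => ?_)
    rw [Real.norm_eq_abs, abs_mul]
    have h := abs_real_inner_le_norm (fderiv ℝ (curl v) x (EuclideanSpace.basisFun (Fin 3) ℝ i)) (fderiv ℝ (fun y : EuclideanSpace ℝ (Fin 3) => fderiv ℝ (fun z : EuclideanSpace ℝ (Fin 3) => (-(v z - c) 1) • EuclideanSpace.single (0 : Fin 3) (1 : ℝ) + ((v z - c) 0) • EuclideanSpace.single (1 : Fin 3) (1 : ℝ)) y (EuclideanSpace.basisFun (Fin 3) ℝ i)) x (EuclideanSpace.single (2 : Fin 3) (1 : ℝ)))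
    have a1 := nDω x _ (nb i); have a2 := nDDB x _ _ (nb i) n2; have hQ := norm_nonneg (iteratedFDeriv ℝ 2 v x)
    have : ‖fderiv ℝ (curl v) x (EuclideanSpace.basisFun (Fin 3) ℝ i)‖ * ‖fderiv ℝ (fun y : EuclideanSpace ℝ (Fin 3) => fderiv ℝ (fun z : EuclideanSpace ℝ (Fin 3) => (-(v z - c) 1) • EuclideanSpace.single (0 : Fin 3) (1 : ℝ) + ((v z - c) 0) • EuclideanSpace.single (1 : Fin 3) (1 : ℝ)) y (EuclideanSpace.basisFun (Fin 3) ℝ i)) x (EuclideanSpace.single (2 : Fin 3) (1 : ℝ))‖ ≤ 4 * ‖iteratedFDeriv ℝ 2 v x‖ ^ 2 := by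
      nlinarith [mul_le_mul a1 a2 (norm_nonneg _) (by positivity)]
    nlinarith [mul_le_mul (hK1 (x 2)) (h.trans this) (abs_nonneg _) hK10]
  have iD9 : Integrable (fun x : EuclideanSpace ℝ (Fin 3) => deriv g (x 2) * ∑ i : Fin 3, (fderiv ℝ (curl v) x (EuclideanSpace.basisFun (Fin 3) ℝ i) 0 *
            fderiv ℝ (fun y => fderiv ℝ v y (EuclideanSpace.single (1 : Fin 3) (1 : ℝ))) x (EuclideanSpace.basisFun (Fin 3) ℝ i) 2 -
          fderiv ℝ (curl v) x (EuclideanSpace.basisFun (Fin 3) ℝ i) 1 *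
            fderiv ℝ (fun y => fderiv ℝ v y (EuclideanSpace.single (0 : Fin 3) (1 : ℝ))) x (EuclideanSpace.basisFun (Fin 3) ℝ i) 2)) volume := by
    refine (iQ2.const_mul (K * 24)).mono' (cg1.mul (continuous_finsetSum _ fun i _ =>
      ((cco 0 (cDω _)).mul (cco 2 (cHv _ _))).sub ((cco 1 (cDω _)).mul (cco 2 (cHv _ _))))).aestronglyMeasurable
      (Eventually.of_forall fun x => ?_)
    rw [Real.norm_eq_abs, abs_mul]
    have hQ := norm_nonneg (iteratedFDeriv ℝ 2 v x)
    have hk : ∀ i : Fin 3, |fderiv ℝ (curl v) x (EuclideanSpace.basisFun (Fin 3) ℝ i) 0 *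
            fderiv ℝ (fun y => fderiv ℝ v y (EuclideanSpace.single (1 : Fin 3) (1 : ℝ))) x (EuclideanSpace.basisFun (Fin 3) ℝ i) 2 -
          fderiv ℝ (curl v) x (EuclideanSpace.basisFun (Fin 3) ℝ i) 1 *
            fderiv ℝ (fun y => fderiv ℝ v y (EuclideanSpace.single (0 : Fin 3) (1 : ℝ))) x (EuclideanSpace.basisFun (Fin 3) ℝ i) 2| ≤ 8 * ‖iteratedFDeriv ℝ 2 v x‖ ^ 2 := fun i => by
      have a1 := nDω x _ (nb i)
      have b0 : |fderiv ℝ (curl v) x (EuclideanSpace.basisFun (Fin 3) ℝ i) 0| ≤ 4 * ‖iteratedFDeriv ℝ 2 v x‖ := (ac _ 0).trans a1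
      have b1 : |fderiv ℝ (curl v) x (EuclideanSpace.basisFun (Fin 3) ℝ i) 1| ≤ 4 * ‖iteratedFDeriv ℝ 2 v x‖ := (ac _ 1).trans a1
      have c1 : |fderiv ℝ (fun y => fderiv ℝ v y (EuclideanSpace.single (1 : Fin 3) (1 : ℝ))) x (EuclideanSpace.basisFun (Fin 3) ℝ i) 2| ≤ ‖iteratedFDeriv ℝ 2 v x‖ := (ac _ 2).trans (nHv x _ _ (by rw [PiLp.norm_single, norm_one]) (nb i))
      have c0 : |fderiv ℝ (fun y => fderiv ℝ v y (EuclideanSpace.single (0 : Fin 3) (1 : ℝ))) x (EuclideanSpace.basisFun (Fin 3) ℝ i) 2| ≤ ‖iteratedFDeriv ℝ 2 v x‖ := (ac _ 2).trans (nHv x _ _ (by rw [PiLp.norm_single, norm_one]) (nb i))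
      refine (abs_sub _ _).trans ?_
      rw [abs_mul, abs_mul]
      nlinarith [mul_le_mul b0 c1 (abs_nonneg _) (by positivity), mul_le_mul b1 c0 (abs_nonneg _) (by positivity)]
    have hs : |∑ i : Fin 3, (fderiv ℝ (curl v) x (EuclideanSpace.basisFun (Fin 3) ℝ i) 0 *
            fderiv ℝ (fun y => fderiv ℝ v y (EuclideanSpace.single (1 : Fin 3) (1 : ℝ))) x (EuclideanSpace.basisFun (Fin 3) ℝ i) 2 -
          fderiv ℝ (curl v) x (EuclideanSpace.basisFun (Fin 3) ℝ i) 1 *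
            fderiv ℝ (fun y => fderiv ℝ v y (EuclideanSpace.single (0 : Fin 3) (1 : ℝ))) x (EuclideanSpace.basisFun (Fin 3) ℝ i) 2)| ≤ 24 * ‖iteratedFDeriv ℝ 2 v x‖ ^ 2 :=
      (Finset.abs_sum_le_sum_abs _ _).trans ((Finset.sum_le_sum fun i _ => hk i).trans (by simp; ring_nf; rfl))
    nlinarith [mul_le_mul (hK1 (x 2)) hs (abs_nonneg _) hK10]
  have hK : (∫ x : EuclideanSpace ℝ (Fin 3), deriv g (x 2) * ∑ i : Fin 3, (fderiv ℝ (curl v) x (EuclideanSpace.basisFun (Fin 3) ℝ i) 0 *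
            fderiv ℝ (fun y => fderiv ℝ v y (EuclideanSpace.single (1 : Fin 3) (1 : ℝ))) x (EuclideanSpace.basisFun (Fin 3) ℝ i) 2 -
          fderiv ℝ (curl v) x (EuclideanSpace.basisFun (Fin 3) ℝ i) 1 *
            fderiv ℝ (fun y => fderiv ℝ v y (EuclideanSpace.single (0 : Fin 3) (1 : ℝ))) x (EuclideanSpace.basisFun (Fin 3) ℝ i) 2)) - (∫ x : EuclideanSpace ℝ (Fin 3), ∑ i : Fin 3, deriv g (x 2) * ⟪fderiv ℝ (curl v) x (EuclideanSpace.basisFun (Fin 3) ℝ i),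
            fderiv ℝ (fun y : EuclideanSpace ℝ (Fin 3) => fderiv ℝ (fun z : EuclideanSpace ℝ (Fin 3) => (-(v z - c) 1) • EuclideanSpace.single (0 : Fin 3) (1 : ℝ) + ((v z - c) 0) • EuclideanSpace.single (1 : Fin 3) (1 : ℝ)) y
              (EuclideanSpace.basisFun (Fin 3) ℝ i)) x (EuclideanSpace.single (2 : Fin 3) (1 : ℝ))⟫) = (∫ x : EuclideanSpace ℝ (Fin 3), deriv g (x 2) * ∑ i : Fin 3, (fderiv ℝ (fun y => fderiv ℝ v y (EuclideanSpace.single (0 : Fin 3) (1 : ℝ))) x (EuclideanSpace.basisFun (Fin 3) ℝ i) 2 ^ 2 + fderiv ℝ (fun y => fderiv ℝ v y (EuclideanSpace.single (1 : Fin 3) (1 : ℝ))) x (EuclideanSpace.basisFun (Fin 3) ℝ i) 2 ^ 2 - fderiv ℝ (fun y => fderiv ℝ v y (EuclideanSpace.basisFun (Fin 3) ℝ i)) x (EuclideanSpace.single (2 : Fin 3) (1 : ℝ)) 0 ^ 2 - fderiv ℝ (fun y => fderiv ℝ v y (EuclideanSpace.basisFun (Fin 3) ℝ i)) x (EuclideanSpace.single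 (2 : Fin 3) (1 : ℝ)) 1 ^ 2)) := by
    rw [← integral_sub iD9 iD7]
    refine integral_congr_ae (Eventually.of_forall fun x => ?_)
    simp only
    rw [fderiv_crossField_sub_const (V := v) c, Finset.mul_sum, ← Finset.sum_sub_distrib, Finset.mul_sum]
    refine Finset.sum_congr rfl fun i _ => ?_
    rw [← slideCoeffDeriv_sub_inner_crossHessian_eq hv2 x (EuclideanSpace.basisFun (Fin 3) ℝ i)]
    ring
  rw [hP, hP2, hD2]
  linarith [hK]

end ExtremiserLiouville

end Summit.NavierStokesRegularity.NavierStokesRegularity.Theorems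

end
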